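import Literature.AlgebraicGeometry.Motives.IntegralProjectiveSpace
import Literature.AlgebraicGeometry.Morphisms.CechH1Projective
import Literature.AlgebraicGeometry.Motives.Varieties
import Mathlib.AlgebraicGeometry.Morphisms.ClosedImmersion
import HarnessLib

/-!
# `P ×_K S ↪ 𝐏^N_{Γ(S)}` for `P ↪ 𝐏^N_K` closed and `S` affine

For a field `K`, a `K`-scheme `P` with a closed immersion `ι₀ : P ↪ 𝐏^N_K` over `K`, and an AFFINE
`K`-scheme `S` with `Λ = Γ(S, 𝒪_S)`, the product `P ×_K S` embeds as a closed subscheme of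
`𝐏^N_Λ = 𝐏^N_K ×_K Spec Λ` (`Motives/IntegralProjectiveSpace`: `ProjBaseChangeRing.isPullback_projMap`,
any algebra over a field being flat), compatibly with the projections to `Spec Λ ≅ S`
(`exists_isClosedImmersion_PP`): the embedding is the base change of `ι₀` along
`𝐏^N_Λ → 𝐏^N_K` (pasting of cartesian squares), hence a closed immersion. This is the form in
which the Serre finiteness file (`Motives/ProjLineBundleSerre`, closed `Z ⊆ 𝐏^r_{Γ(B, 𝒪_B)}` over
`B`) is applied to Chow covers of products. Fully proved; no named facts.

## References

* Q. Liu, *Algebraic Geometry and Arithmetic Curves* (2002), Prop. 3.1.9, Ex. 3.1.10. [Liu2002]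
-/

universe u

open CategoryTheory CategoryTheory.Limits AlgebraicGeometry MonoidalCategory CartesianMonoidalCategory
open Literature.AlgebraicGeometry.Morphisms.ProjCech

noncomputable section

namespace Literature.AlgebraicGeometry.Motives

variable {K : Type u} [Field K]

attribute [local instance] MvPolynomial.gradedAlgebra


/-- **`P ×_K S ↪ 𝐏^N_{Γ(S, 𝒪_S)}` as a closed subscheme over `S`** for `ι₀ : P ↪ 𝐏^N_K` a closed
immersion over `K` and `S` affine: there is a closed immersion `ι : P ×_K S → 𝐏^N_Λ`,
`Λ = Γ(S, 𝒪_S)`, with `ι ≫ (𝐏^N_Λ → Spec Λ) = pr_S ≫ (S ⥲ Spec Λ)`. [cite: Liu2002, Ex. 3.1.10] -/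
theorem exists_isClosedImmersion_PP (P S : SchemeOver K) [IsAffine S.left] {N : ℕ}
    (ι₀ : P.left ⟶ PP K N) [IsClosedImmersion ι₀] (hι₀ : ι₀ ≫ toSpec K N = P.hom) :
    ∃ ι : (P ⊗ S).left ⟶ PP Γ(S.left, ⊤) N, IsClosedImmersion ι ∧
      ι ≫ toSpec Γ(S.left, ⊤) N = (snd P S).left ≫ S.left.toSpecΓ := by
  -- `Λ = Γ(S, 𝒪_S)` as a `K`-algebra through `S → Spec K`
  let κ : CommRingCat.of K ⟶ Γ(S.left, ⊤) := (Scheme.ΓSpecIso (.of K)).inv ≫ S.hom.appTop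
  letI : Algebra K Γ(S.left, ⊤) := κ.hom.toAlgebra
  have hκ : CommRingCat.ofHom (algebraMap K Γ(S.left, ⊤)) = κ := rfl
  -- `S → Spec K` factors as `S ⥲ Spec Λ → Spec K`
  have hS : S.hom = S.left.toSpecΓ ≫ Spec.map κ := by
    have h := Scheme.toSpecΓ_naturality S.hom
    rw [← SpecMap_ΓSpecIso_hom] at h
    rw [Spec.map_comp, ← reassoc_of% h, ← Spec.map_comp, Iso.inv_hom_id, Spec.map_id,
      Category.comp_id]
  -- the cartesian square `𝐏^N_Λ = 𝐏^N_K ×_K Spec Λ`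
  have hPB := ProjBaseChangeRing.isPullback_projMap K Γ(S.left, ⊤) (Fin (N + 1))
  rw [hκ] at hPB
  -- the product square `P ×_K S`, with the corner `S ⥲ Spec Λ`
  have hT : IsPullback (snd P S).left (fst P S).left S.hom P.hom := (IsPullback.of_hasPullback _ _).flip
  have hcorner : IsPullback S.left.toSpecΓ S.hom (Spec.map κ) (𝟙 _) :=
    IsPullback.of_horiz_isIso ⟨by rw [Category.comp_id, hS]⟩
  have houter : IsPullback ((snd P S).left ≫ S.left.toSpecΓ) (fst P S).left (Spec.map κ)
      (P.hom ≫ 𝟙 _) := hT.paste_horiz hcorner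
  -- the lift
  have w : ((fst P S).left ≫ ι₀) ≫ toSpec K N = ((snd P S).left ≫ S.left.toSpecΓ) ≫ Spec.map κ := by
    rw [Category.assoc, hι₀, Category.assoc, ← hS]
    exact Over.w (fst P S) |>.trans (Over.w (snd P S)).symm
  refine ⟨hPB.lift _ _ w, ?_, hPB.lift_snd _ _ w⟩
  -- closed immersion: base change of `ι₀` along `𝐏^N_Λ → 𝐏^N_K`
  have hsq : IsPullback (hPB.lift _ _ w) (fst P S).left
      (Proj.map (ProjBaseChangeRing.mapGraded K Γ(S.left, ⊤) (Fin (N + 1)))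
        (ProjBaseChangeRing.irrelevant_le_map K Γ(S.left, ⊤) (Fin (N + 1)))) ι₀ := by
    refine IsPullback.of_right ?_ (hPB.lift_fst _ _ w) hPB.flip
    rw [hPB.lift_snd, hι₀]
    simpa only [Category.comp_id] using houter
  exact MorphismProperty.of_isPullback hsq.flip inferInstance

end Literature.AlgebraicGeometry.Motives

end
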